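import Literature.NumberTheory.EllipticCurves.TunnellWeightThreeHalvesBasisProofs
import Literature.NumberTheory.EllipticCurves.TunnellThmTwoSupersingularProofs
import HarnessLib

/-!
# `T(p²)(g θ₈) = a_p(E) · g θ₈` at the supersingular primes `p ≡ 3 (mod 4)`, unconditionally

Assembly of `TunnellWeightThreeHalvesBasisProofs` (`g θ₈` is an eigenform of every `T(p²)`,
`p` odd, with eigenvalue the coefficient of `q¹` — unconditional since (CO) is proved there) and
`TunnellThmTwoSupersingularProofs` (that coefficient is `d₈(p²) + (-1/p) = 0 = a_p(E)` for
`p ≡ 3 (mod 4)`): at every prime `p ≡ 3 (mod 4)` the statement of Tunnell's Theorem 2 for `g θ₈`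
holds on the nose, `T(p²)(g θ₈) = a_p(E) g θ₈` (`heckeTSq_tunnellForm_eight_supersingular`).
What remains of the Shimura–Niwa input (SN) for `g θ₈` is the ordinary half `p ≡ 1 (mod 4)`:
`d₈(p²) + 1 = 2a` for `p = a² + b²`, `a ≡ (-1)^{b/2} (mod 4)`-normalised (numerically:
`∑_{1 ≤ s ≤ p/4} (-1)^s r₂(s(p - 4s)) = a_p(E) - 2`), the genuine content of the Shimura lift of
this form; and both halves for `g(θ₂ - θ₈)`. No definitions, no named facts.

## References

* J. B. Tunnell, *A classical Diophantine problem and modular forms of weight 3/2*, Invent. Math.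
  72 (1983) 323–334, Thm 2 and its proof, pp. 327–328. [Tunnell1983Congruent]
-/

noncomputable section

namespace Literature.NumberTheory.EllipticCurves.Tunnell1983

open Literature.NumberTheory.EllipticCurves.ModularForms

/-- **`T(p²)(g θ₈) = a_p(E) · g θ₈` for every prime `p ≡ 3 (mod 4)`** (both sides vanish:
`g θ₈` is a `T(p²)`-eigenform with eigenvalue `d₈(p²) + (-1/p) = 1 - 1 = 0`, and `a_p(E) = 0` at
the supersingular primes of `E : y² = x³ - x`). This is Theorem 2 of Tunnell for `g θ₈` at these
primes, proved without the Shimura lift. [cite: Tunnell1983Congruent, Thm 2 and its proof, pp. 327–328] -/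
theorem heckeTSq_tunnellForm_eight_supersingular {p : ℕ} (hp : p.Prime) (hp3 : p % 4 = 3) :
    heckeTSq 3 (1 : DirichletCharacter ℂ 128) p (qCoeffs (tunnellForm 8)) =
      tunnellEigenvalues p • qCoeffs (tunnellForm 8) := by
  rw [heckeTSq_tunnellForm_eight_eigen hp (by omega),
    heckeTSq_tunnellForm_eight_one_eq_tunnellEigenvalues hp hp3]

/-- The same, spelled out: `T(p²)(g θ₈) = 0` for every prime `p ≡ 3 (mod 4)`.
[cite: Tunnell1983Congruent, Thm 2 and its proof, pp. 327–328] -/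
theorem heckeTSq_tunnellForm_eight_eq_zero_of_mod_four {p : ℕ} (hp : p.Prime) (hp3 : p % 4 = 3) :
    heckeTSq 3 (1 : DirichletCharacter ℂ 128) p (qCoeffs (tunnellForm 8)) = 0 := by
  rw [heckeTSq_tunnellForm_eight_supersingular hp hp3, tunnellEigenvalues_eq_zero_of_mod_four hp hp3,
    zero_smul]

end Literature.NumberTheory.EllipticCurves.Tunnell1983
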